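/-
Copyright: width seat `ym-line-sll-p2` (prover-ym-line-sll-p2-g2-0), route `SoftLoopLongLag`, crux T′ `ColdBoxSoftLoopLagFloor`
(stmt-QuantumFields-24180), line `birth`, registered stub E1a `stub_innerFlatLagFloorG`, brick 2.
-/
import Summits.QuantumFields.YangMills.Theorems.SoftLoopLongLagInnerFlatSurfaceGauss
import Summits.QuantumFields.YangMills.Theorems.ColdBoxAllGroupsBoxFloorAllGroupsGaussSideD

/-!
# Route `SoftLoopLongLag`, crux T′, stub E1a `stub_innerFlatLagFloorG`, brick E1a-2 «LoopGaussSide»: the Gaussian side of the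
# one-scale expansion for the soft LOOP observable — moments and the colour/Wick identity of the loop quadratic surrogate under
# `gaussD H D = boxDirichlet H ^{⊗D}` (G-free)

Loop counterpart of the sibling brick `ColdBoxAllGroupsBoxFloorAllGroupsGaussSideD` (there: one plaquette, `qObsD`).  For a finite index set
`C` (the time-zero cube of base points), a family of spanning surfaces `A : Site 4 → Finset (ZdPlaquette 4)` with `#(A x) ≤ a` on `C`, and a
constant `c ≥ 0` (in the application `c = 1/(2N)`), the **loop quadratic surrogate** of the cube-smeared soft-loop observable is
`Q_A(t) = Σ_{x∈C} c · Σ_{i<D} X_{A x}(t_i)²`, `X_A = Σ_{p∈A} dirCirc H p` the surface sum of brick E1a-1 (the abelianised loop: `β·N⁻¹·cost`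
of the loop is `(2N)⁻¹ Σ_i Φ_i²` to second order, `Φ_i` the colour-`i` flux).  Written out, no new definition.

* `integral_sum_surfSum_pow_even_le_D` — `∫ Σ_i X_A(t_i)^{2r} d(gaussD) ≤ D·((#A)²)^r·(2r−1)!!`;
* `memLp_two_loopQ` — `Q_A ∈ L²(gaussD)`, `∫ Q_A² ≤ K²`, `K = 2·c·D·#C·a²`; `memLp_two_loopQ_mul_loopQ` — `∫ (Q_A Q_B)² ≤ (3K²)²`;
* **`cov_loopQ_gaussD_eq`** — the colour/Wick identity
  `Cov_{gaussD}(Q_A, Q_B) = 2c²·D · Σ_{x∈C} Σ_{y∈C} (Σ_{p∈A x} Σ_{q∈B y} boxDirProjKernel H p q)²`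
  (independent colours do not cross-correlate, `cov_colourSum_pi`; per colour Wick `integral_surfSum_sq_mul_sq_sub`) — with `c = 1/(2N)` the
  Gaussian constant `D/(2N²)` in front of the sum of squared Dirichlet mutual inductances, the Dirichlet dress of the route's `wickLagSum`.
No sorry; no new definition; standard axioms.  HONEST LABEL: rung R2xi-G RECORD label (leaf `WeakCouplingRates.XiPow`, an UPPER bound on the
lattice mass gap); NOT the Clay mass gap; no summit statement is touched.

References: S. Janson, *Gaussian Hilbert Spaces* (1997) Thm 1.28; S. Chatterjee, arXiv:1602.01222 §13.
-/

set_option autoImplicit false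

noncomputable section

open MeasureTheory ProbabilityTheory Finset
open scoped Nat NNReal
open Literature.Probability.LatticeModels (Site)
open Literature.MathematicalPhysics.QuantumLattice
open Literature.MathematicalPhysics.QuantumFieldTheory
open Literature.MathematicalPhysics.QuantumFieldTheory.LatticeMaxwell
open Literature.MathematicalPhysics.QuantumFieldTheory.AxialGauge
open Summit.QuantumFields.YangMills.Theorems.WeakCouplingRates
open Summit.QuantumFields.YangMills.Theorems.ColdBoxAllGroups (TSpaceD gaussD integral_comp_eval_gaussD integrable_comp_eval_gaussD)

namespace Summit.QuantumFields.YangMills.Theorems.SoftLoopLongLag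

variable {H D : ℕ}

/-! ## Colour sums of even powers of one surface sum -/

/-- `∫ Σ_i X_A(t_i)^{2r} d(gaussD) ≤ D·((#A)²)^r·(2r−1)!!`, with integrability. -/
theorem integral_sum_surfSum_pow_even_le_D (A : Finset (ZdPlaquette 4)) (r : ℕ) :
    Integrable (fun t : TSpaceD H D => ∑ i, (∑ p ∈ A, dirCirc H (p.1, p.2.1.1, p.2.1.2) (t i)) ^ (2 * r)) (gaussD H D) ∧
      ∫ t, ∑ i, (∑ p ∈ A, dirCirc H (p.1, p.2.1.1, p.2.1.2) (t i)) ^ (2 * r) ∂(gaussD H D) ≤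
        (D : ℝ) * ((((#A : ℝ)) ^ 2) ^ r * ((2 * r - 1 : ℕ)‼ : ℝ)) := by
  obtain ⟨hint, hle⟩ := integral_surfSum_pow_even_le (H := H) A r
  have hc : ∀ i : Fin D, Integrable (fun t : TSpaceD H D => (∑ p ∈ A, dirCirc H (p.1, p.2.1.1, p.2.1.2) (t i)) ^ (2 * r))
      (gaussD H D) := fun i =>
    integrable_comp_eval_gaussD (f := fun s => (∑ p ∈ A, dirCirc H (p.1, p.2.1.1, p.2.1.2) s) ^ (2 * r))
      ((measurable_surfSum A).pow_const _) hint i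
  refine ⟨integrable_finsetSum _ fun i _ => hc i, ?_⟩
  rw [integral_finsetSum _ fun i _ => hc i]
  calc ∑ i : Fin D, ∫ t, (∑ p ∈ A, dirCirc H (p.1, p.2.1.1, p.2.1.2) (t i)) ^ (2 * r) ∂(gaussD H D)
      = ∑ _i : Fin D, ∫ s, (∑ p ∈ A, dirCirc H (p.1, p.2.1.1, p.2.1.2) s) ^ (2 * r) ∂(boxDirichlet H) :=
        Finset.sum_congr rfl fun i _ =>
          integral_comp_eval_gaussD (fun s => (∑ p ∈ A, dirCirc H (p.1, p.2.1.1, p.2.1.2) s) ^ (2 * r)) i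
    _ ≤ ∑ _i : Fin D, (((#A : ℝ)) ^ 2) ^ r * ((2 * r - 1 : ℕ)‼ : ℝ) := Finset.sum_le_sum fun i _ => hle
    _ = _ := by rw [Finset.sum_const, Finset.card_univ, Fintype.card_fin, nsmul_eq_mul]

/-! ## The loop quadratic surrogate: measurability and pointwise power means -/

/-- The loop surrogate is measurable. -/
theorem measurable_loopQ (C : Finset (Site 4)) (A : Site 4 → Finset (ZdPlaquette 4)) (c : ℝ) :
    Measurable fun t : TSpaceD H D => ∑ x ∈ C, c * ∑ i, (∑ p ∈ A x, dirCirc H (p.1, p.2.1.1, p.2.1.2) (t i)) ^ 2 :=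
  Finset.measurable_sum _ fun x _ => measurable_const.mul
    (Finset.measurable_sum _ fun i _ => ((measurable_surfSum (A x)).comp (measurable_pi_apply i)).pow_const 2)

/-- The loop surrogate is nonnegative (`c ≥ 0`). -/
theorem loopQ_nonneg (C : Finset (Site 4)) (A : Site 4 → Finset (ZdPlaquette 4)) {c : ℝ} (hc : 0 ≤ c) (t : TSpaceD H D) :
    0 ≤ ∑ x ∈ C, c * ∑ i, (∑ p ∈ A x, dirCirc H (p.1, p.2.1.1, p.2.1.2) (t i)) ^ 2 :=
  Finset.sum_nonneg fun _ _ => mul_nonneg hc (Finset.sum_nonneg fun _ _ => sq_nonneg _)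

/-- Pointwise: `Q² ≤ #C · c² · D · Σ_x Σ_i X⁴` (Cauchy–Schwarz twice). -/
theorem loopQ_sq_le (C : Finset (Site 4)) (A : Site 4 → Finset (ZdPlaquette 4)) (c : ℝ) (t : TSpaceD H D) :
    (∑ x ∈ C, c * ∑ i, (∑ p ∈ A x, dirCirc H (p.1, p.2.1.1, p.2.1.2) (t i)) ^ 2) ^ 2 ≤
      (#C : ℝ) * (c ^ 2 * ((D : ℝ) * ∑ x ∈ C, ∑ i, (∑ p ∈ A x, dirCirc H (p.1, p.2.1.1, p.2.1.2) (t i)) ^ 4)) := by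
  have h1 := sq_sum_le_card_mul_sum_sq (s := C)
    (f := fun x => c * ∑ i, (∑ p ∈ A x, dirCirc H (p.1, p.2.1.1, p.2.1.2) (t i)) ^ 2)
  refine h1.trans (mul_le_mul_of_nonneg_left ?_ (Nat.cast_nonneg _))
  rw [Finset.mul_sum, Finset.mul_sum]
  refine Finset.sum_le_sum fun x _ => ?_
  have h2 := sq_sum_le_card_mul_sum_sq (s := (Finset.univ : Finset (Fin D)))
    (f := fun i => (∑ p ∈ A x, dirCirc H (p.1, p.2.1.1, p.2.1.2) (t i)) ^ 2)
  rw [Finset.card_univ, Fintype.card_fin] at h2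
  have e4 : ∀ i : Fin D, ((∑ p ∈ A x, dirCirc H (p.1, p.2.1.1, p.2.1.2) (t i)) ^ 2) ^ 2 =
      (∑ p ∈ A x, dirCirc H (p.1, p.2.1.1, p.2.1.2) (t i)) ^ 4 := fun i => by ring
  simp only [e4] at h2
  rw [mul_pow]
  exact mul_le_mul_of_nonneg_left h2 (sq_nonneg _)

/-- Pointwise: `Q⁴ ≤ #C³ · c⁴ · D³ · Σ_x Σ_i X⁸`. -/
theorem loopQ_pow_four_le (C : Finset (Site 4)) (A : Site 4 → Finset (ZdPlaquette 4)) (c : ℝ) (t : TSpaceD H D) :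
    (∑ x ∈ C, c * ∑ i, (∑ p ∈ A x, dirCirc H (p.1, p.2.1.1, p.2.1.2) (t i)) ^ 2) ^ 4 ≤
      (#C : ℝ) ^ 3 * (c ^ 4 * ((D : ℝ) ^ 3 * ∑ x ∈ C, ∑ i, (∑ p ∈ A x, dirCirc H (p.1, p.2.1.1, p.2.1.2) (t i)) ^ 8)) := by
  set y : Site 4 → Fin D → ℝ := fun x i => (∑ p ∈ A x, dirCirc H (p.1, p.2.1.1, p.2.1.2) (t i)) ^ 2 with hy
  -- first Cauchy–Schwarz over `C`, twice
  have h1 := sq_sum_le_card_mul_sum_sq (s := C) (f := fun x => c * ∑ i, y x i)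
  have h1' := sq_sum_le_card_mul_sum_sq (s := C) (f := fun x => (c * ∑ i, y x i) ^ 2)
  have hC : (0 : ℝ) ≤ #C := Nat.cast_nonneg _
  have step1 : (∑ x ∈ C, c * ∑ i, y x i) ^ 4 ≤ (#C : ℝ) ^ 3 * ∑ x ∈ C, (c * ∑ i, y x i) ^ 4 := by
    have e : ∀ x, ((c * ∑ i, y x i) ^ 2) ^ 2 = (c * ∑ i, y x i) ^ 4 := fun x => by ring
    simp only [e] at h1'
    calc (∑ x ∈ C, c * ∑ i, y x i) ^ 4 = ((∑ x ∈ C, c * ∑ i, y x i) ^ 2) ^ 2 := by ring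
      _ ≤ ((#C : ℝ) * ∑ x ∈ C, (c * ∑ i, y x i) ^ 2) ^ 2 := pow_le_pow_left₀ (sq_nonneg _) h1 2
      _ = (#C : ℝ) ^ 2 * (∑ x ∈ C, (c * ∑ i, y x i) ^ 2) ^ 2 := by ring
      _ ≤ (#C : ℝ) ^ 2 * ((#C : ℝ) * ∑ x ∈ C, (c * ∑ i, y x i) ^ 4) := mul_le_mul_of_nonneg_left h1' (by positivity)
      _ = (#C : ℝ) ^ 3 * ∑ x ∈ C, (c * ∑ i, y x i) ^ 4 := by ring
  -- then over the colours
  have step2 : ∀ x, (c * ∑ i, y x i) ^ 4 ≤ c ^ 4 * ((D : ℝ) ^ 3 * ∑ i, y x i ^ 4) := fun x => by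
    rw [mul_pow]
    exact mul_le_mul_of_nonneg_left (ColdBoxAllGroups.pow_four_sum_le (y x)) (by positivity)
  have e8 : ∀ x i, y x i ^ 4 = (∑ p ∈ A x, dirCirc H (p.1, p.2.1.1, p.2.1.2) (t i)) ^ 8 := fun x i => by rw [hy]; ring
  calc (∑ x ∈ C, c * ∑ i, y x i) ^ 4 ≤ (#C : ℝ) ^ 3 * ∑ x ∈ C, (c * ∑ i, y x i) ^ 4 := step1
    _ ≤ (#C : ℝ) ^ 3 * ∑ x ∈ C, c ^ 4 * ((D : ℝ) ^ 3 * ∑ i, y x i ^ 4) :=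
        mul_le_mul_of_nonneg_left (Finset.sum_le_sum fun x _ => step2 x) (by positivity)
    _ = (#C : ℝ) ^ 3 * (c ^ 4 * ((D : ℝ) ^ 3 * ∑ x ∈ C, ∑ i, (∑ p ∈ A x, dirCirc H (p.1, p.2.1.1, p.2.1.2) (t i)) ^ 8)) := by
        simp only [e8, Finset.mul_sum]

/-! ## Second moments under `gaussD` -/

/-- **Second moment of the loop surrogate**: `Q_A ∈ L²(gaussD)` and `∫ Q_A² ≤ (2·c·D·#C·a²)²` when `#(A x) ≤ a` on `C`. -/
theorem memLp_two_loopQ (C : Finset (Site 4)) (A : Site 4 → Finset (ZdPlaquette 4)) {c a : ℝ}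
    (hA : ∀ x ∈ C, (#(A x) : ℝ) ≤ a) :
    MemLp (fun t : TSpaceD H D => ∑ x ∈ C, c * ∑ i, (∑ p ∈ A x, dirCirc H (p.1, p.2.1.1, p.2.1.2) (t i)) ^ 2) 2 (gaussD H D) ∧
      ∫ t, (∑ x ∈ C, c * ∑ i, (∑ p ∈ A x, dirCirc H (p.1, p.2.1.1, p.2.1.2) (t i)) ^ 2) ^ 2 ∂(gaussD H D) ≤
        (2 * c * D * #C * a ^ 2) ^ 2 := by
  have hD : (0 : ℝ) ≤ D := Nat.cast_nonneg _
  have hCn : (0 : ℝ) ≤ #C := Nat.cast_nonneg _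
  have hint4 : ∀ x, Integrable (fun t : TSpaceD H D => ∑ i, (∑ p ∈ A x, dirCirc H (p.1, p.2.1.1, p.2.1.2) (t i)) ^ 4)
      (gaussD H D) := fun x => by
    have h := (integral_sum_surfSum_pow_even_le_D (H := H) (D := D) (A x) 2).1
    simpa using h
  have hle4 : ∀ x ∈ C, ∫ t, ∑ i, (∑ p ∈ A x, dirCirc H (p.1, p.2.1.1, p.2.1.2) (t i)) ^ 4 ∂(gaussD H D) ≤
      (D : ℝ) * (a ^ 4 * 3) := fun x hx => by
    have h := (integral_sum_surfSum_pow_even_le_D (H := H) (D := D) (A x) 2).2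
    have h' : ∫ t, ∑ i, (∑ p ∈ A x, dirCirc H (p.1, p.2.1.1, p.2.1.2) (t i)) ^ 4 ∂(gaussD H D) ≤
        (D : ℝ) * ((((#(A x) : ℝ)) ^ 2) ^ 2 * ((2 * 2 - 1 : ℕ)‼ : ℝ)) := by simpa using h
    refine h'.trans (mul_le_mul_of_nonneg_left ?_ hD)
    have hcard : ((#(A x) : ℝ) ^ 2) ^ 2 ≤ a ^ 4 := by
      rw [← pow_mul]; exact pow_le_pow_left₀ (Nat.cast_nonneg _) (hA x hx) 4
    norm_num [Nat.doubleFactorial]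
    nlinarith
  set B : TSpaceD H D → ℝ := fun t =>
    (#C : ℝ) * (c ^ 2 * ((D : ℝ) * ∑ x ∈ C, ∑ i, (∑ p ∈ A x, dirCirc H (p.1, p.2.1.1, p.2.1.2) (t i)) ^ 4)) with hB
  have hdom : Integrable B (gaussD H D) := ((integrable_finsetSum _ fun x _ => hint4 x).const_mul _).const_mul _ |>.const_mul _
  have hmeas := measurable_loopQ (H := H) (D := D) C A c
  have hsq : Integrable (fun t : TSpaceD H D =>
      (∑ x ∈ C, c * ∑ i, (∑ p ∈ A x, dirCirc H (p.1, p.2.1.1, p.2.1.2) (t i)) ^ 2) ^ 2) (gaussD H D) :=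
    hdom.mono' ((hmeas.pow_const 2).aestronglyMeasurable) (ae_of_all _ fun t => by
      rw [Real.norm_eq_abs, abs_of_nonneg (sq_nonneg _)]; exact loopQ_sq_le C A c t)
  refine ⟨(memLp_two_iff_integrable_sq hmeas.aestronglyMeasurable).2 hsq, ?_⟩
  calc ∫ t, (∑ x ∈ C, c * ∑ i, (∑ p ∈ A x, dirCirc H (p.1, p.2.1.1, p.2.1.2) (t i)) ^ 2) ^ 2 ∂(gaussD H D)
      ≤ ∫ t, B t ∂(gaussD H D) := integral_mono hsq hdom fun t => loopQ_sq_le C A c t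
    _ = (#C : ℝ) * (c ^ 2 * ((D : ℝ) * ∑ x ∈ C, ∫ t, ∑ i, (∑ p ∈ A x, dirCirc H (p.1, p.2.1.1, p.2.1.2) (t i)) ^ 4 ∂(gaussD H D))) := by
        simp only [hB]
        rw [integral_const_mul, integral_const_mul, integral_const_mul, integral_finsetSum _ fun x _ => hint4 x]
    _ ≤ (#C : ℝ) * (c ^ 2 * ((D : ℝ) * ∑ x ∈ C, (D : ℝ) * (a ^ 4 * 3))) := by
        gcongr with x hx
        exact hle4 x hx
    _ = 3 * (c * D * #C * a ^ 2) ^ 2 := by rw [Finset.sum_const, nsmul_eq_mul]; ring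
    _ ≤ (2 * c * D * #C * a ^ 2) ^ 2 := by nlinarith [sq_nonneg (c * D * #C * a ^ 2)]

/-- **Second moment of a product of loop surrogates** (same cube `C`, surface families `A`, `B` with `#(A x), #(B x) ≤ a`):
`Q_A·Q_B ∈ L²(gaussD)` and `∫ (Q_A Q_B)² ≤ (3K²)²`, `K = 2·c·D·#C·a²`. -/
theorem memLp_two_loopQ_mul_loopQ (C : Finset (Site 4)) (A B : Site 4 → Finset (ZdPlaquette 4)) {c a : ℝ}
    (hA : ∀ x ∈ C, (#(A x) : ℝ) ≤ a) (hB : ∀ x ∈ C, (#(B x) : ℝ) ≤ a) :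
    MemLp (fun t : TSpaceD H D => (∑ x ∈ C, c * ∑ i, (∑ p ∈ A x, dirCirc H (p.1, p.2.1.1, p.2.1.2) (t i)) ^ 2) *
        (∑ x ∈ C, c * ∑ i, (∑ p ∈ B x, dirCirc H (p.1, p.2.1.1, p.2.1.2) (t i)) ^ 2)) 2 (gaussD H D) ∧
      ∫ t, ((∑ x ∈ C, c * ∑ i, (∑ p ∈ A x, dirCirc H (p.1, p.2.1.1, p.2.1.2) (t i)) ^ 2) *
          (∑ x ∈ C, c * ∑ i, (∑ p ∈ B x, dirCirc H (p.1, p.2.1.1, p.2.1.2) (t i)) ^ 2)) ^ 2 ∂(gaussD H D) ≤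
        (3 * (2 * c * D * #C * a ^ 2) ^ 2) ^ 2 := by
  have hD : (0 : ℝ) ≤ D := Nat.cast_nonneg _
  have hCn : (0 : ℝ) ≤ #C := Nat.cast_nonneg _
  -- eighth moments
  have hint8 : ∀ (E : Finset (ZdPlaquette 4)), Integrable (fun t : TSpaceD H D =>
      ∑ i, (∑ p ∈ E, dirCirc H (p.1, p.2.1.1, p.2.1.2) (t i)) ^ 8) (gaussD H D) := fun E => by
    have h := (integral_sum_surfSum_pow_even_le_D (H := H) (D := D) E 4).1
    simpa using h
  have hle8 : ∀ (E : Finset (ZdPlaquette 4)), (#E : ℝ) ≤ a →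
      ∫ t, ∑ i, (∑ p ∈ E, dirCirc H (p.1, p.2.1.1, p.2.1.2) (t i)) ^ 8 ∂(gaussD H D) ≤ (D : ℝ) * (a ^ 8 * 105) := fun E hE => by
    have h := (integral_sum_surfSum_pow_even_le_D (H := H) (D := D) E 4).2
    have h' : ∫ t, ∑ i, (∑ p ∈ E, dirCirc H (p.1, p.2.1.1, p.2.1.2) (t i)) ^ 8 ∂(gaussD H D) ≤
        (D : ℝ) * ((((#E : ℝ)) ^ 2) ^ 4 * ((2 * 4 - 1 : ℕ)‼ : ℝ)) := by simpa using h
    refine h'.trans (mul_le_mul_of_nonneg_left ?_ hD)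
    have hcard : ((#E : ℝ) ^ 2) ^ 4 ≤ a ^ 8 := by
      rw [← pow_mul]; exact pow_le_pow_left₀ (Nat.cast_nonneg _) hE 8
    norm_num [Nat.doubleFactorial]
    nlinarith
  set QA : TSpaceD H D → ℝ := fun t => ∑ x ∈ C, c * ∑ i, (∑ p ∈ A x, dirCirc H (p.1, p.2.1.1, p.2.1.2) (t i)) ^ 2 with hQA
  set QB : TSpaceD H D → ℝ := fun t => ∑ x ∈ C, c * ∑ i, (∑ p ∈ B x, dirCirc H (p.1, p.2.1.1, p.2.1.2) (t i)) ^ 2 with hQB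
  set S8 : (Site 4 → Finset (ZdPlaquette 4)) → TSpaceD H D → ℝ := fun E t =>
    ∑ x ∈ C, ∑ i, (∑ p ∈ E x, dirCirc H (p.1, p.2.1.1, p.2.1.2) (t i)) ^ 8 with hS8
  set Bd : TSpaceD H D → ℝ := fun t => (#C : ℝ) ^ 3 * (c ^ 4 * ((D : ℝ) ^ 3 * S8 A t)) / 2 +
    (#C : ℝ) ^ 3 * (c ^ 4 * ((D : ℝ) ^ 3 * S8 B t)) / 2 with hBd
  have hintS8 : ∀ E : Site 4 → Finset (ZdPlaquette 4), Integrable (S8 E) (gaussD H D) := fun E => by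
    simp only [hS8]; exact integrable_finsetSum _ fun x _ => hint8 (E x)
  have hdom : Integrable Bd (gaussD H D) :=
    ((((hintS8 A).const_mul _).const_mul _).const_mul _ |>.div_const 2).add
      ((((hintS8 B).const_mul _).const_mul _).const_mul _ |>.div_const 2)
  have hpt : ∀ t, (QA t * QB t) ^ 2 ≤ Bd t := fun t => by
    have h1 : QA t ^ 4 ≤ (#C : ℝ) ^ 3 * (c ^ 4 * ((D : ℝ) ^ 3 * S8 A t)) := loopQ_pow_four_le C A c t
    have h2 : QB t ^ 4 ≤ (#C : ℝ) ^ 3 * (c ^ 4 * ((D : ℝ) ^ 3 * S8 B t)) := loopQ_pow_four_le C B c t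
    have hamgm : (QA t * QB t) ^ 2 ≤ (QA t ^ 4 + QB t ^ 4) / 2 := by nlinarith [sq_nonneg (QA t ^ 2 - QB t ^ 2)]
    simp only [hBd]
    linarith
  have hmeas : Measurable fun t => QA t * QB t :=
    (measurable_loopQ (H := H) (D := D) C A c).mul (measurable_loopQ (H := H) (D := D) C B c)
  have hsq : Integrable (fun t => (QA t * QB t) ^ 2) (gaussD H D) :=
    hdom.mono' ((hmeas.pow_const 2).aestronglyMeasurable) (ae_of_all _ fun t => by
      rw [Real.norm_eq_abs, abs_of_nonneg (sq_nonneg _)]; exact hpt t)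
  refine ⟨(memLp_two_iff_integrable_sq hmeas.aestronglyMeasurable).2 hsq, ?_⟩
  have hI8 : ∀ E : Site 4 → Finset (ZdPlaquette 4), (∀ x ∈ C, (#(E x) : ℝ) ≤ a) →
      ∫ t, S8 E t ∂(gaussD H D) ≤ (#C : ℝ) * ((D : ℝ) * (a ^ 8 * 105)) := fun E hE => by
    simp only [hS8]
    rw [integral_finsetSum _ fun x _ => hint8 (E x)]
    calc ∑ x ∈ C, ∫ t, ∑ i, (∑ p ∈ E x, dirCirc H (p.1, p.2.1.1, p.2.1.2) (t i)) ^ 8 ∂(gaussD H D)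
        ≤ ∑ x ∈ C, (D : ℝ) * (a ^ 8 * 105) := Finset.sum_le_sum fun x hx => hle8 (E x) (hE x hx)
      _ = _ := by rw [Finset.sum_const, nsmul_eq_mul]
  have hc4 : 0 ≤ (#C : ℝ) ^ 3 * (c ^ 4 * (D : ℝ) ^ 3) := by positivity
  calc ∫ t, (QA t * QB t) ^ 2 ∂(gaussD H D) ≤ ∫ t, Bd t ∂(gaussD H D) := integral_mono hsq hdom hpt
    _ = (#C : ℝ) ^ 3 * (c ^ 4 * ((D : ℝ) ^ 3 * ∫ t, S8 A t ∂(gaussD H D))) / 2 +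
          (#C : ℝ) ^ 3 * (c ^ 4 * ((D : ℝ) ^ 3 * ∫ t, S8 B t ∂(gaussD H D))) / 2 := by
        simp only [hBd]
        rw [integral_add, integral_div, integral_div, integral_const_mul, integral_const_mul, integral_const_mul,
          integral_const_mul, integral_const_mul, integral_const_mul]
        · exact (((hintS8 A).const_mul _).const_mul _).const_mul _ |>.div_const 2
        · exact (((hintS8 B).const_mul _).const_mul _).const_mul _ |>.div_const 2
    _ ≤ (#C : ℝ) ^ 3 * (c ^ 4 * ((D : ℝ) ^ 3 * ((#C : ℝ) * ((D : ℝ) * (a ^ 8 * 105))))) / 2 +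
          (#C : ℝ) ^ 3 * (c ^ 4 * ((D : ℝ) ^ 3 * ((#C : ℝ) * ((D : ℝ) * (a ^ 8 * 105))))) / 2 := by
        gcongr
        · exact hI8 A hA
        · exact hI8 B hB
    _ = 105 * (c * D * #C * a ^ 2) ^ 4 := by ring
    _ ≤ (3 * (2 * c * D * #C * a ^ 2) ^ 2) ^ 2 := by nlinarith [pow_nonneg (sq_nonneg (c * D * #C * a ^ 2)) 2]

/-! ## The colour/Wick identity -/

/-- `c·X_A²` is square integrable under `boxDirichlet H`. -/
theorem memLp_two_const_mul_surfSum_sq (A : Finset (ZdPlaquette 4)) (c : ℝ) :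
    MemLp (fun s : EuclideanSpace ℝ (DirFree H) => c * (∑ p ∈ A, dirCirc H (p.1, p.2.1.1, p.2.1.2) s) ^ 2) 2 (boxDirichlet H) := by
  have h := (memLp_two_half_surfSum_sq (H := H) A).const_mul (2 * c)
  exact h.ae_eq (ae_of_all _ fun s => by simp only; ring)

/-- One-colour covariance of the cube sums: `Cov_D(Σ_x c X_{A x}², Σ_y c X_{B y}²) = 2c² Σ_x Σ_y (E_D[X_{A x} X_{B y}])²`. -/
theorem cov_cubeSum_surfSum_sq_eq (C : Finset (Site 4)) (A B : Site 4 → Finset (ZdPlaquette 4)) (c : ℝ) :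
    (∫ s, (∑ x ∈ C, c * (∑ p ∈ A x, dirCirc H (p.1, p.2.1.1, p.2.1.2) s) ^ 2) *
          (∑ y ∈ C, c * (∑ q ∈ B y, dirCirc H (q.1, q.2.1.1, q.2.1.2) s) ^ 2) ∂(boxDirichlet H)) -
        (∫ s, ∑ x ∈ C, c * (∑ p ∈ A x, dirCirc H (p.1, p.2.1.1, p.2.1.2) s) ^ 2 ∂(boxDirichlet H)) *
          (∫ s, ∑ y ∈ C, c * (∑ q ∈ B y, dirCirc H (q.1, q.2.1.1, q.2.1.2) s) ^ 2 ∂(boxDirichlet H)) =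
      2 * c ^ 2 * ∑ x ∈ C, ∑ y ∈ C,
        (∑ p ∈ A x, ∑ q ∈ B y, boxDirProjKernel H (p.1, p.2.1.1, p.2.1.2) (q.1, q.2.1.1, q.2.1.2)) ^ 2 := by
  set X : Finset (ZdPlaquette 4) → EuclideanSpace ℝ (DirFree H) → ℝ :=
    fun E s => ∑ p ∈ E, dirCirc H (p.1, p.2.1.1, p.2.1.2) s with hX
  have hL2 : ∀ E : Finset (ZdPlaquette 4), MemLp (fun s => c * X E s ^ 2) 2 (boxDirichlet H) := fun E =>
    memLp_two_const_mul_surfSum_sq E c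
  have hI : ∀ E : Finset (ZdPlaquette 4), Integrable (fun s => c * X E s ^ 2) (boxDirichlet H) := fun E =>
    (hL2 E).integrable one_le_two
  have hIprod : ∀ E F : Finset (ZdPlaquette 4), Integrable (fun s => c * X E s ^ 2 * (c * X F s ^ 2)) (boxDirichlet H) :=
    fun E F => (hL2 E).integrable_mul (hL2 F)
  change (∫ s, (∑ x ∈ C, c * X (A x) s ^ 2) * (∑ y ∈ C, c * X (B y) s ^ 2) ∂(boxDirichlet H)) -
      (∫ s, ∑ x ∈ C, c * X (A x) s ^ 2 ∂(boxDirichlet H)) * (∫ s, ∑ y ∈ C, c * X (B y) s ^ 2 ∂(boxDirichlet H)) = _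
  -- expand the product of sums and integrate termwise
  have h1 : ∫ s, (∑ x ∈ C, c * X (A x) s ^ 2) * (∑ y ∈ C, c * X (B y) s ^ 2) ∂(boxDirichlet H) =
      ∑ x ∈ C, ∑ y ∈ C, ∫ s, c * X (A x) s ^ 2 * (c * X (B y) s ^ 2) ∂(boxDirichlet H) := by
    simp_rw [Finset.sum_mul_sum]
    rw [integral_finsetSum _ fun x _ => integrable_finsetSum _ fun y _ => hIprod (A x) (B y)]
    refine Finset.sum_congr rfl fun x _ => ?_
    rw [integral_finsetSum _ fun y _ => hIprod (A x) (B y)]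
  have h2 : ∫ s, ∑ x ∈ C, c * X (A x) s ^ 2 ∂(boxDirichlet H) = ∑ x ∈ C, ∫ s, c * X (A x) s ^ 2 ∂(boxDirichlet H) :=
    integral_finsetSum _ fun x _ => hI (A x)
  have h3 : ∫ s, ∑ y ∈ C, c * X (B y) s ^ 2 ∂(boxDirichlet H) = ∑ y ∈ C, ∫ s, c * X (B y) s ^ 2 ∂(boxDirichlet H) :=
    integral_finsetSum _ fun y _ => hI (B y)
  -- per pair: Wick
  have h4 : ∀ x y, (∫ s, c * X (A x) s ^ 2 * (c * X (B y) s ^ 2) ∂(boxDirichlet H)) -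
      (∫ s, c * X (A x) s ^ 2 ∂(boxDirichlet H)) * (∫ s, c * X (B y) s ^ 2 ∂(boxDirichlet H)) =
        2 * c ^ 2 * (∑ p ∈ A x, ∑ q ∈ B y, boxDirProjKernel H (p.1, p.2.1.1, p.2.1.2) (q.1, q.2.1.1, q.2.1.2)) ^ 2 := by
    intro x y
    have hw := integral_surfSum_sq_mul_sq_sub (H := H) (A x) (B y)
    rw [integral_surfSum_mul_surfSum] at hw
    have e1 : ∫ s, c * X (A x) s ^ 2 * (c * X (B y) s ^ 2) ∂(boxDirichlet H) =
        c ^ 2 * ∫ s, X (A x) s ^ 2 * X (B y) s ^ 2 ∂(boxDirichlet H) := by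
      rw [← integral_const_mul]; refine integral_congr_ae (ae_of_all _ fun s => ?_); ring
    have e2 : ∫ s, c * X (A x) s ^ 2 ∂(boxDirichlet H) = c * ∫ s, X (A x) s ^ 2 ∂(boxDirichlet H) := integral_const_mul _ _
    have e3 : ∫ s, c * X (B y) s ^ 2 ∂(boxDirichlet H) = c * ∫ s, X (B y) s ^ 2 ∂(boxDirichlet H) := integral_const_mul _ _
    rw [e1, e2, e3]
    have hw' : (∫ s, X (A x) s ^ 2 * X (B y) s ^ 2 ∂(boxDirichlet H)) =
        (∫ s, X (A x) s ^ 2 ∂(boxDirichlet H)) * (∫ s, X (B y) s ^ 2 ∂(boxDirichlet H)) +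
          2 * (∑ p ∈ A x, ∑ q ∈ B y, boxDirProjKernel H (p.1, p.2.1.1, p.2.1.2) (q.1, q.2.1.1, q.2.1.2)) ^ 2 := by
      simp only [hX] at hw ⊢; linarith
    rw [hw']; ring
  rw [h1, h2, h3, Finset.sum_mul_sum, ← Finset.sum_sub_distrib]
  simp_rw [← Finset.sum_sub_distrib, h4]
  rw [Finset.mul_sum]
  refine Finset.sum_congr rfl fun x _ => ?_
  rw [Finset.mul_sum]

/-- **The colour/Wick identity for the loop surrogates** (same cube `C`, surface families `A`, `B`, constant `c`):
`Cov_{gaussD}(Q_A, Q_B) = 2c²·D·Σ_{x∈C} Σ_{y∈C} (Σ_{p∈A x} Σ_{q∈B y} boxDirProjKernel H p q)²`. -/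
theorem cov_loopQ_gaussD_eq (C : Finset (Site 4)) (A B : Site 4 → Finset (ZdPlaquette 4)) (c : ℝ) :
    (∫ t, (∑ x ∈ C, c * ∑ i, (∑ p ∈ A x, dirCirc H (p.1, p.2.1.1, p.2.1.2) (t i)) ^ 2) *
          (∑ x ∈ C, c * ∑ i, (∑ p ∈ B x, dirCirc H (p.1, p.2.1.1, p.2.1.2) (t i)) ^ 2) ∂(gaussD H D)) -
        (∫ t, ∑ x ∈ C, c * ∑ i, (∑ p ∈ A x, dirCirc H (p.1, p.2.1.1, p.2.1.2) (t i)) ^ 2 ∂(gaussD H D)) *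
          (∫ t, ∑ x ∈ C, c * ∑ i, (∑ p ∈ B x, dirCirc H (p.1, p.2.1.1, p.2.1.2) (t i)) ^ 2 ∂(gaussD H D)) =
      2 * c ^ 2 * D * ∑ x ∈ C, ∑ y ∈ C,
        (∑ p ∈ A x, ∑ q ∈ B y, boxDirProjKernel H (p.1, p.2.1.1, p.2.1.2) (q.1, q.2.1.1, q.2.1.2)) ^ 2 := by
  -- one-colour functions
  set f : EuclideanSpace ℝ (DirFree H) → ℝ := fun s => ∑ x ∈ C, c * (∑ p ∈ A x, dirCirc H (p.1, p.2.1.1, p.2.1.2) s) ^ 2 with hf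
  set g : EuclideanSpace ℝ (DirFree H) → ℝ := fun s => ∑ y ∈ C, c * (∑ q ∈ B y, dirCirc H (q.1, q.2.1.1, q.2.1.2) s) ^ 2 with hg
  have hQA : ∀ t : TSpaceD H D, ∑ x ∈ C, c * ∑ i, (∑ p ∈ A x, dirCirc H (p.1, p.2.1.1, p.2.1.2) (t i)) ^ 2 = ∑ i, f (t i) := by
    intro t; simp only [hf, Finset.mul_sum]; rw [Finset.sum_comm]
  have hQB : ∀ t : TSpaceD H D, ∑ x ∈ C, c * ∑ i, (∑ p ∈ B x, dirCirc H (p.1, p.2.1.1, p.2.1.2) (t i)) ^ 2 = ∑ i, g (t i) := by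
    intro t; simp only [hg, Finset.mul_sum]; rw [Finset.sum_comm]
  simp_rw [hQA, hQB]
  have hfL2 := memLp_finsetSum' (μ := boxDirichlet H) (p := 2) C fun x _ => memLp_two_const_mul_surfSum_sq (H := H) (A x) c
  have hgL2 := memLp_finsetSum' (μ := boxDirichlet H) (p := 2) C fun y _ => memLp_two_const_mul_surfSum_sq (H := H) (B y) c
  have hfL2' : MemLp f 2 (boxDirichlet H) :=
    hfL2.ae_eq (ae_of_all _ fun s => by simp only [hf, Finset.sum_apply])
  have hgL2' : MemLp g 2 (boxDirichlet H) :=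
    hgL2.ae_eq (ae_of_all _ fun s => by simp only [hg, Finset.sum_apply])
  have h := cov_colourSum_pi (ι := Fin D) (boxDirichlet H) f g hfL2' hgL2'
  rw [gaussD, h, Fintype.card_fin]
  have hcube := cov_cubeSum_surfSum_sq_eq (H := H) C A B c
  simp only [hf, hg] at hcube ⊢
  rw [hcube]
  ring

end Summit.QuantumFields.YangMills.Theorems.SoftLoopLongLag

end
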